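import Literature.Topology.FourManifolds.TrisectionsSectorNormalForm
import Literature.Topology.FourManifolds.AdaptedMorseConnected
import HarnessLib

/-!
# From the normal form back to Gay–Kirby's sector clauses

Topic `Literature/Topology/FourManifolds`; infrastructure for the fact seat
`provefact-Literature.Topology.FourManifolds.exists-14560f9fc8` (named fact (c′)
`Literature.Topology.FourManifolds.exists_stabilized_gkTrisection`, Gay–Kirby 2016, Def. 8 and
Lemma 10).  Everything in this file is **proved**; no definitions, no named facts.

A trisection in normal form (`TriNormalForm`, `TrisectionsSectorNormalForm.lean`) with counts
`handleCount 1 (k m)` satisfies the cover clause and the three **sector clauses** of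
`IsGKTrisection X g k S` (`TriNormalForm.sector_clause`): the recognition theorem
`sectorClause_of_ambient` gives the straightened sector with its handle decomposition, the
single `0`-handle makes it connected (`HasHandleDecomposition.connectedSpace`), and the pairwise
disjointness of interiors puts `S m ∩ S m'` on the boundary.  Consequently a normal form plus the
face clause is a Gay–Kirby trisection (`isGKTrisection_of_triNormalForm`), and the stabilised
counts are `handleCount 1 (k m + 1)` (`handleCount_add_indicator_one`).

## References

* D. Gay, R. Kirby, *Trisecting 4-manifolds*, Geom. Topol. 20 (2016) 3097–3132, Def. 1,
  Def. 8, Lemma 10. [GayKirby2016]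
-/

open scoped Manifold ContDiff Topology
open Set Function Filter

noncomputable section

namespace Literature.Topology.FourManifolds

universe u

/-- The stabilised counts: `handleCount 1 k + [n = 1] = handleCount 1 (k + 1)`.
[cite: GayKirby2016, Def. 8] -/
theorem handleCount_add_indicator_one (k : ℕ) :
    (fun n => handleCount 1 k n + if n = 1 then 1 else 0) = handleCount 1 (k + 1) := by
  funext n
  unfold handleCount
  rcases n with _ | _ | n <;> simp

section Clauses

variable {X : Type u} [TopologicalSpace X]
  [ChartedSpace (EuclideanSpace ℝ (Fin 4)) X] [IsManifold (𝓡 4) ∞ X]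

/-- **The sector clause of `IsGKTrisection` from a sector in normal form** (generic in the
normal coordinates), given that the non-interior points of `Sm` contain `Sm ∩ S m'` for the
other sectors. [cite: GayKirby2016, Def. 1] -/
theorem SectorNormalForm.sector_clause {S : Fin 3 → Set X} {m : Fin 3} {u v : X → ℝ} {ρ : X → X}
    {U O : Set X} {km : ℕ}
    (hS : SectorNormalForm (S m) (⋂ l, S l) u v ρ U O (handleCount 1 km))
    (hdisj : ∀ m', m ≠ m' → Disjoint (interior (S m)) (S m')) :
    ∃ (W : Type u) (_ : TopologicalSpace W) (_ : ChartedSpace (EuclideanHalfSpace 4) W)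
      (e : W → X), IsManifold (𝓡∂ 4) ∞ W ∧ CompactSpace W ∧ ConnectedSpace W ∧
        HasHandleDecomposition 3 W (handleCount 1 km) ∧
        Topology.IsEmbedding e ∧ range e = S m ∧
        (∀ w, e w ∉ (⋂ l, S l) → Manifold.IsImmersionAt (𝓡∂ 4) (𝓡 4) ∞ e w) ∧
        (∀ w, e w ∈ (⋂ l, S l) → IsCornerAt e w) ∧
        ∀ j, j ≠ m → S m ∩ S j ⊆ e '' (𝓡∂ 4).boundary W := by
  obtain ⟨G, κ, Oκ, hGs, hκs, hOκo, hFOκ, -, hκpos, hκρ, hGform, hb1, hi1, hb2, hi2, -, hc⟩ := hS.morse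
  have hcd : ∀ x ∈ ⋂ l, S l, ∃ C : CornerSliceChart (S m) (⋂ l, S l) u v ρ, x ∈ C.Θ.source :=
    fun x hx => by obtain ⟨C, hxC, -⟩ := hS.corner x hx; exact ⟨C, hxC⟩
  obtain ⟨W, _, _, e, hM, hWc, hHD, hemb, hrange, himm, hcor, hbd⟩ :=
    sectorClause_of_ambient hS.isCompact hcd hS.half hGs hOκo hFOκ hκs hκpos hκρ
      (fun y _ hyO => hGform y hyO) hb1 hi1 hb2 hi2 hc
  haveI := hHD.connectedSpace (handleCount_zero 1 km)
  refine ⟨W, inferInstance, inferInstance, e, hM, hWc, inferInstance, hHD, hemb, hrange, himm, hcor,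
    fun j hj y hy => hbd y hy.1 fun hyint => ?_⟩
  exact Set.disjoint_left.1 (hdisj j hj.symm) hyint hy.2

variable {S : Fin 3 → Set X} {i j l : Fin 3} {u v : X → ℝ} {ρ : X → X} {U O : Set X}
  {k : Fin 3 → ℕ}

/-- **The three sector clauses of `IsGKTrisection` from a trisection in normal form.**
[cite: GayKirby2016, Def. 1] -/
theorem TriNormalForm.sector_clause (hT : TriNormalForm S i j l u v ρ U O (fun m => handleCount 1 (k m)))
    (m : Fin 3) :
    ∃ (W : Type u) (_ : TopologicalSpace W) (_ : ChartedSpace (EuclideanHalfSpace 4) W)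
      (e : W → X), IsManifold (𝓡∂ 4) ∞ W ∧ CompactSpace W ∧ ConnectedSpace W ∧
        HasHandleDecomposition 3 W (handleCount 1 (k m)) ∧
        Topology.IsEmbedding e ∧ range e = S m ∧
        (∀ w, e w ∉ (⋂ l, S l) → Manifold.IsImmersionAt (𝓡∂ 4) (𝓡 4) ∞ e w) ∧
        (∀ w, e w ∈ (⋂ l, S l) → IsCornerAt e w) ∧
        ∀ j, j ≠ m → S m ∩ S j ⊆ e '' (𝓡∂ 4).boundary W := by
  rcases hT.eq_or m with h | h | h <;> rw [h]
  · exact hT.sector_i.sector_clause (hT.disjoint i)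
  · exact hT.sector_j.sector_clause (hT.disjoint j)
  · exact hT.sector_l.sector_clause (hT.disjoint l)

/-- **A trisection in normal form with the face clause is a Gay–Kirby trisection.**
[cite: GayKirby2016, Def. 1] -/
theorem isGKTrisection_of_triNormalForm {g : ℕ}
    (hT : TriNormalForm S i j l u v ρ U O (fun m => handleCount 1 (k m)))
    (hface : ∀ i j, i ≠ j → ∃ (H : Type u) (_ : TopologicalSpace H)
      (_ : ChartedSpace (EuclideanHalfSpace 3) H) (h : H → X), IsManifold (𝓡∂ 3) ∞ H ∧
        CompactSpace H ∧ ConnectedSpace H ∧ HasHandleDecomposition 2 H (handleCount 1 g) ∧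
        Manifold.IsSmoothEmbedding (𝓡∂ 3) (𝓡 4) ∞ h ∧ range h = S i ∩ S j ∧
        h '' (𝓡∂ 3).boundary H = ⋂ l, S l) :
    IsGKTrisection X g k S :=
  ⟨hT.cover, hT.sector_clause, hface⟩

end Clauses

end Literature.Topology.FourManifolds
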